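import Summits.KontsevichZagierPeriods.KontsevichZagierPeriods.Theorems.LiftingCriteriaCubeNashNormalFormTame
import Literature.NumberTheory.Transcendental.SemialgebraicMaps
import Mathlib.RingTheory.Polynomial.Resultant.Basic
import Mathlib.Analysis.Analytic.Basic
import Mathlib.Analysis.Calculus.FDeriv.Analytic
import Mathlib.MeasureTheory.Measure.Lebesgue.Basic
import Literature.AlgebraicGeometry.Resolution.CubeMonomialChartsPrincipalization

/-!
# Crux `CubeNashNormalForm` (stmt-KontsevichZagierPeriods-3574), line `Sketch` — stub `stub_toricPrincipalization`

Worker start file generated by the line lead: the statement below is BYTE-IDENTICAL to the registered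
stub signature (do not edit it; the gate matches name + signature). Replace `sorry` by a proof; add
helper lemmas ABOVE the theorem in this namespace (docstring on every declaration); keep ≤ 400 lines
(generic lemmas belong in a Literature/ file proposed separately and imported here).
-/

noncomputable section

open Set MeasureTheory
open Literature.ModelTheory.ExponentialFields (IsSemialgebraic)
open Literature.NumberTheory.Transcendental
open Literature.NumberTheory.Transcendental.KZ

namespace Summit.KontsevichZagierPeriods.SymplecticScissors.CubeNashNormalFormToricPrincipalization

/-- **Stub S6 `stub_toricPrincipalization` (simplicial toric charts, M–L).** For a finite set `S` of
exponent vectors in `ℕⁿ` there are finitely many monomial maps `v ↦ (∏ⱼ vⱼ^{A i j})ᵢ`, `A ∈ ℕ^{n×n}`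
with `det A ≠ 0`, whose open-cube images are pairwise disjoint and cover the open cube up to a null
set, such that on each chart the pulled-back exponents `Aᵀa`, `a ∈ S`, are pairwise comparable
componentwise: in logarithmic coordinates `L = −log v ∈ (0,∞)ⁿ` these are the maximal cones (columns
of `A` = rational ray generators) of any SIMPLICIAL fan refining the chambers of the arrangement
`⟨a − b, L⟩ = 0` (`a, b ∈ S`) inside the positive orthant. [Fulton 1993, §2.6; Goward 2005, §2] -/
theorem stub_toricPrincipalization : ∀ n : ℕ, (∀ (S : Finset (Fin n → ℕ)), ∃ (M : ℕ) (A : Fin M → Matrix (Fin n) (Fin n) ℕ), (∀ c, ((A c).map (fun t : ℕ => (t : ℝ))).det ≠ 0) ∧ Pairwise (fun c c' => Disjoint ((fun v : Fin n → ℝ => fun i => ∏ j, v j ^ A c i j) '' Set.pi Set.univ (fun _ : Fin n => Set.Ioo (0:ℝ) 1)) ((fun v : Fin n → ℝ => fun i => ∏ j, v j ^ A c' i j) '' Set.pi Set.univ (fun _ : Fin n => Set.Ioo (0:ℝ) 1))) ∧ MeasureTheory.volume (Set.pi Set.univ (fun _ : Fin n => Set.Ioo (0:ℝ) 1) \ ⋃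 c, (fun v : Fin n → ℝ => fun i => ∏ j, v j ^ A c i j) '' Set.pi Set.univ (fun _ : Fin n => Set.Ioo (0:ℝ) 1)) = 0 ∧ ∀ c, ∀ a ∈ S, ∀ b ∈ S, (∀ j, ∑ i, A c i j * a i ≤ ∑ i, A c i j * b i) ∨ (∀ j, ∑ i, A c i j * b i ≤ ∑ i, A c i j * a i)) := by
  intro n S
  exact Literature.AlgebraicGeometry.Resolution.MonomialCubeChart.exists_cube_charts_pairwise_comparable
    n S

end Summit.KontsevichZagierPeriods.SymplecticScissors.CubeNashNormalFormToricPrincipalization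

end
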